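import Literature.NumberTheory.LFunctions.Zhang2022.RepairSection9Boxes

/-!
# Zhang (2022) §§8–9: the pair form `𝔠(θ)` in a box — interval lengths, boxed coefficients, certificate readers

Trunk T-ANT (NumberTheory/LFunctions). Companion of `RepairSection9Theta.lean` (the Hermitian pair form
`pairForm k_L k_S ν_L ν_S u_L u_S = |u_L|²c_LL + u_Lū_Sc_LS + ū_Lu_Sc̄_LS + |u_S|²c_SS` behind `𝔠₁` (§8) and
`𝔠₂` (§9) of Y. Zhang, arXiv:2211.02515v1 [Zhang2022LandauSiegel] — **an unrefereed manuscript under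
adjudication; nothing here asserts any of its claims**) and of `RepairSection9Boxes.lean` (boxes `cDiagBL`,
`cCrossBL` of the entries at INTERVAL lengths, flags `bDiagOK`, `cCrossOK`).

**Content.** The top layer the repair-or-barrier rung (D-0077) evaluates: `pairFormBL k_L k_S V_L V_S U_L U_S`,
the box of the whole form for lengths `ν_L ∈ V_L`, `ν_S ∈ V_S` (intervals) and coefficients `u_L ∈ U_L`,
`u_S ∈ U_S` (complex boxes — a point `ι` or a cell of `ι`'s), its flag `pairFormOK`, the soundness lemma
`mem_pairFormBL`, and the two certificate readers `pairForm_re_gt_of_cert` / `pairForm_re_lt_of_cert`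
(a rational threshold against the integer endpoints; `decide +kernel`). A Q1 point certificate uses
`V = FI.ofRat q`, a Q2 cover leaf uses `V = FI.ofRatRat lo hi` — same lemma. **Regression**:
`pairForm_sec8_re_bounds`, `pairForm_sec9_re_bounds` certify the generic form at the two printed designs
(`7.0501 < · < 7.05011`, `6.987092 < · < 6.987093`) and `frakc12_re_mem_generic_brackets` transports them to
the tree's `𝔠₁`, `𝔠₂ᶜ` (= `Section8Certificate.frakc1_re_bounds`, `Section18Certificate.frakc2c_re_bounds`
re-derived through the θ-generic pipeline — the term a certificate at another design uses, with new numerals).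

What is NOT here: any admissibility condition on the design, `𝔠₃` and the §10 constants, and any statement
about Theorems 1–2 of the manuscript.
-/

noncomputable section

open Complex Real ComplexConjugate
open Literature.Analysis.ValidatedNumerics.Numerics

namespace Literature.NumberTheory.LFunctions.Zhang2022

/- As in `Section8Certificate`: keep the interval primitives opaque to the unifier. -/
attribute [local irreducible] CB.add CB.sub CB.mul CB.neg CB.conj CB.mulFI CB.mulI CB.mulInt
  CB.ofFI CB.ofInt CB.normSqFI CB.expI FI.add FI.sub FI.mul FI.neg FI.mulInt FI.divNat FI.divPos
  FI.ofRat FI.ofInt FI.pi qCB piMul expIpi overPiFI piISq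

/-- **box of the pair form** for lengths in `V_L, V_S` and coefficients in `U_L, U_S`:
`|u_L|²c_LL + u_Lū_S c_LS + ū_Lu_S c̄_LS + |u_S|²c_SS` evaluated entrywise in boxes.
[cite: Zhang2022LandauSiegel, (8.23) p.50, (9.7) p.52] -/
@[irreducible] def pairFormBL (kL kS : ℚ) (VL VS : FI) (UL US : CB) : CB :=
  ((((CB.ofFI UL.normSqFI).mul (cDiagBL kL VL)).add ((UL.mul US.conj).mul (cCrossBL kL kS VL VS))).add
    ((UL.conj.mul US).mul (cCrossBL kL kS VL VS).conj)).add ((CB.ofFI US.normSqFI).mul (cDiagBL kS VS))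

/-- validity flags of `pairFormBL` (the flags of its two diagonal and its cross enclosure).
[cite: Zhang2022LandauSiegel, (8.23) p.50] -/
def pairFormOK (kL kS : ℚ) (VL VS : FI) : Bool :=
  bDiagOK kL VL && bDiagOK kS VS && cCrossOK kL kS VL VS

/-- **the pair form lies in its box**: for `k_L, k_S ≠ 0`, `k_L ≠ k_S`, lengths `ν_L ∈ V_L`, `ν_S ∈ V_S`,
coefficients `u_L ∈ U_L`, `u_S ∈ U_S`, flags set. [cite: Zhang2022LandauSiegel, (8.23) p.50, (9.7) p.52] -/
theorem mem_pairFormBL {kL kS : ℚ} (hkL : kL ≠ 0) (hkS : kS ≠ 0) (hne : kL ≠ kS) {νL νS : ℝ}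
    {VL VS : FI} (hνL : FI.mem νL VL) (hνS : FI.mem νS VS) (hf : pairFormOK kL kS VL VS = true)
    {uL uS : ℂ} {UL US : CB} (huL : CB.mem uL UL) (huS : CB.mem uS US) :
    CB.mem (pairForm kL kS νL νS uL uS) (pairFormBL kL kS VL VS UL US) := by
  simp only [pairFormOK, Bool.and_eq_true] at hf
  obtain ⟨⟨hL, hS⟩, hC⟩ := hf
  have h1 := mem_cDiagBL hkL hνL hL
  have h2 := mem_cDiagBL hkS hνS hS
  have h3 := mem_cCrossBL hkL hkS hne hνL hνS hC
  unfold pairForm pairFormBL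
  apply_rules [CB.mem_add, CB.mem_mul, CB.mem_conj, CB.mem_ofFI, CB.mem_normSqFI]

/-- **certificate reader, lower side**: a rational threshold below the box bounds `Re` of the form from
below, for every design in the box. [cite: Zhang2022LandauSiegel, (8.24) p.50, (9.8) p.52] -/
theorem pairForm_re_gt_of_cert {kL kS : ℚ} (hkL : kL ≠ 0) (hkS : kS ≠ 0) (hne : kL ≠ kS) {νL νS : ℝ}
    {VL VS : FI} (hνL : FI.mem νL VL) (hνS : FI.mem νS VS) (hf : pairFormOK kL kS VL VS = true)
    {uL uS : ℂ} {UL US : CB} (huL : CB.mem uL UL) (huS : CB.mem uS US)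
    {q : ℚ} (h : q * (SC : ℚ) < ((pairFormBL kL kS VL VS UL US).re.lo : ℚ)) :
    (q : ℝ) < (pairForm kL kS νL νS uL uS).re :=
  lo_bound (mem_pairFormBL hkL hkS hne hνL hνS hf huL huS).1 h

/-- **certificate reader, upper side**. [cite: Zhang2022LandauSiegel, (8.24) p.50, (9.8) p.52] -/
theorem pairForm_re_lt_of_cert {kL kS : ℚ} (hkL : kL ≠ 0) (hkS : kS ≠ 0) (hne : kL ≠ kS) {νL νS : ℝ}
    {VL VS : FI} (hνL : FI.mem νL VL) (hνS : FI.mem νS VS) (hf : pairFormOK kL kS VL VS = true)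
    {uL uS : ℂ} {UL US : CB} (huL : CB.mem uL UL) (huS : CB.mem uS US)
    {q : ℚ} (h : ((pairFormBL kL kS VL VS UL US).re.hi : ℚ) < q * (SC : ℚ)) :
    (pairForm kL kS νL νS uL uS).re < (q : ℝ) :=
  hi_bound (mem_pairFormBL hkL hkS hne hνL hνS hf huL huS).1 h

/-! ### Regression at the printed design: `𝔠₁` and `𝔠₂ᶜ` through the generic pipeline -/

/-- the point boxes at the printed §8 design `(k₆, k₇, ν₁, ν₂) = (3/2, 5/2, 63/125, 1/2)`, coefficients
`(1, ι₂)`, and at the printed §9 design `(k₇, k₆, ν₂, ν₃) = (5/2, 3/2, 1/2, 249/500)`, coefficients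
`(ῑ₄, ῑ₃)`. [cite: Zhang2022LandauSiegel, (8.23) p.50, (9.7) p.52] -/
def sec8Box : CB := pairFormBL (3/2) (5/2) (FI.ofRat (63/125)) (FI.ofRat (1/2)) (CB.ofInt 1) iota2B

/-- the point box at the printed §9 design `(k₇, k₆, ν₂, ν₃) = (5/2, 3/2, 1/2, 249/500)`, coefficients `(ῑ₄, ῑ₃)`.
[cite: Zhang2022LandauSiegel, (9.7) p.52] -/
def sec9Box : CB := pairFormBL (5/2) (3/2) (FI.ofRat (1/2)) (FI.ofRat (249/500)) iota4B.conj iota3B.conj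

/-- the comparisons of the regression certificate (`decide +kernel`): flags at both printed designs and
the four endpoint inequalities. [cite: Zhang2022LandauSiegel, (8.24) p.50, (9.8) p.52] -/
def RegressionCert : Prop :=
  pairFormOK (3/2) (5/2) (FI.ofRat (63/125)) (FI.ofRat (1/2)) = true
  ∧ pairFormOK (5/2) (3/2) (FI.ofRat (1/2)) (FI.ofRat (249/500)) = true
  ∧ ((7.0501 : ℚ) * (SC : ℚ) < (sec8Box.re.lo : ℚ) ∧ (sec8Box.re.hi : ℚ) < (7.05011 : ℚ) * (SC : ℚ))
  ∧ ((6.987092 : ℚ) * (SC : ℚ) < (sec9Box.re.lo : ℚ) ∧ (sec9Box.re.hi : ℚ) < (6.987093 : ℚ) * (SC : ℚ))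

/-- Decidability of the regression comparisons. [folklore] -/
instance : Decidable RegressionCert := by unfold RegressionCert; infer_instance

/-- the kernel check of the regression certificate. [cite: Zhang2022LandauSiegel, (8.24) p.50, (9.8) p.52] -/
theorem regressionCert_holds : RegressionCert := by
  unfold RegressionCert sec8Box sec9Box; decide +kernel

/-- **regression, §8**: the GENERIC functional, boxes and reader certify the pair form at the printed §8 design,
`7.0501 < Re pairForm(3/2, 5/2, 0.504, 0.5; 1, ι₂) < 7.05011` — by `frakc1_eq_pairForm` this is `𝔠₁`, and the
bracket is `Section8Certificate.frakc1_re_bounds` re-derived through the θ-generic pipeline (the term a certificate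
at another design uses, with new numerals). [cite: Zhang2022LandauSiegel, (8.24) p.50] -/
theorem pairForm_sec8_re_bounds :
    (7.0501 : ℝ) < (pairForm (3/2) (5/2) ((63/125 : ℚ) : ℝ) ((1/2 : ℚ) : ℝ) 1 iota2).re
      ∧ (pairForm (3/2) (5/2) ((63/125 : ℚ) : ℝ) ((1/2 : ℚ) : ℝ) 1 iota2).re < 7.05011 := by
  obtain ⟨hok, -, ⟨hlo, hhi⟩, -⟩ := regressionCert_holds
  have hν1 := FI.mem_ofRat (63/125 : ℚ)
  have hν2 := FI.mem_ofRat (1/2 : ℚ)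
  have h1 : CB.mem (1 : ℂ) (CB.ofInt 1) := mem_oneCB
  have lo := pairForm_re_gt_of_cert (by norm_num) (by norm_num) (by norm_num) hν1 hν2 hok h1 mem_iota2
    (by unfold sec8Box at hlo; exact hlo)
  have hi := pairForm_re_lt_of_cert (by norm_num) (by norm_num) (by norm_num) hν1 hν2 hok h1 mem_iota2
    (by unfold sec8Box at hhi; exact hhi)
  exact ⟨by exact_mod_cast lo, by exact_mod_cast hi⟩

/-- **regression, §9**: `6.987092 < Re pairForm(5/2, 3/2, 0.5, 0.498; ῑ₄, ῑ₃) < 6.987093` — by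
`frakc2c_eq_pairForm` this is `𝔠₂ᶜ` (`Section18Certificate.frakc2c_re_bounds`, re-derived generically).
[cite: Zhang2022LandauSiegel, (9.8) p.52] -/
theorem pairForm_sec9_re_bounds :
    (6.987092 : ℝ) < (pairForm (5/2) (3/2) ((1/2 : ℚ) : ℝ) ((249/500 : ℚ) : ℝ) (conj iota4) (conj iota3)).re
      ∧ (pairForm (5/2) (3/2) ((1/2 : ℚ) : ℝ) ((249/500 : ℚ) : ℝ) (conj iota4) (conj iota3)).re < 6.987093 := by
  obtain ⟨-, hok, -, ⟨hlo, hhi⟩⟩ := regressionCert_holds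
  have hν2 := FI.mem_ofRat (1/2 : ℚ)
  have hν3 := FI.mem_ofRat (249/500 : ℚ)
  have h4 := CB.mem_conj mem_iota4
  have h3 := CB.mem_conj mem_iota3
  have lo := pairForm_re_gt_of_cert (by norm_num) (by norm_num) (by norm_num) hν2 hν3 hok h4 h3
    (by unfold sec9Box at hlo; exact hlo)
  have hi := pairForm_re_lt_of_cert (by norm_num) (by norm_num) (by norm_num) hν2 hν3 hok h4 h3
    (by unfold sec9Box at hhi; exact hhi)
  exact ⟨by exact_mod_cast lo, by exact_mod_cast hi⟩

/-- the two generic brackets ARE brackets of the tree's `𝔠₁`, `𝔠₂ᶜ` (transport along `frakc1_eq_pairForm`,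
`frakc2c_eq_pairForm`; cf. `Section8Certificate.frakc1_re_bounds`, `Section18Certificate.frakc2c_re_bounds`).
[cite: Zhang2022LandauSiegel, (8.24) p.50, (9.8) p.52] -/
theorem frakc12_re_mem_generic_brackets :
    frakc1.re ∈ Set.Ioo (7.0501 : ℝ) 7.05011 ∧ frakc2c.re ∈ Set.Ioo (6.987092 : ℝ) 6.987093 := by
  have e1 : frakc1 = pairForm (3/2) (5/2) ((63/125 : ℚ) : ℝ) ((1/2 : ℚ) : ℝ) 1 iota2 := by
    rw [frakc1_eq_pairForm]; norm_num
  have e2 : frakc2c = pairForm (5/2) (3/2) ((1/2 : ℚ) : ℝ) ((249/500 : ℚ) : ℝ) (conj iota4) (conj iota3) := by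
    rw [frakc2c_eq_pairForm]; norm_num
  rw [e1, e2]
  exact ⟨pairForm_sec8_re_bounds, pairForm_sec9_re_bounds⟩

end Literature.NumberTheory.LFunctions.Zhang2022
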